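import Literature.NumberTheory.Automorphic.UnitaryBruhatIwahoriThree   -- ★ BI FILE 2 (p853060): `U = B·K₀`, `U = B·K₁`, `d·w ∈ K₁`; FILE 1 (p853045): level tests, `w ∈ K₀`
import HarnessLib

/-!
# The two vertex stabilisers generate: `K₀ ⊔ K₁ = U(σ, Φ₃)(K)` — any isometric involution, any uniformiser, every residue characteristic
# (Serre 1980 Trees I §4.1 Thm. 6, II §1.4; Bruhat–Tits 1972 (4.4.3); Tits 1979 §2.4, §3.3; Kottwitz 1988 §2)

THEOREMS ONLY (no definition ∕ instance ∕ notation ∕ named fact ∕ `sorry`).  Topic `NumberTheory/Automorphic`; namespace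
`Literature.NumberTheory.Automorphic.UnitaryGroup`.  Rule-20 brick (G8) «LEVELS GENERATE» of the G-row ledger (dealer F0P3a-p09 (g14), 2026-09-03; E1 row 29 of
F0P3a-p03 (g29) moved to the G ledger), cell `pub/hodgecm-mathlib`, crux H413 = `stmt-HodgeConjecture-24833`, `--supports` lane; seat LH6-p03 (g9).

SETTING exactly as ★ `UnitaryIwahoriSubgroupThree` ∕ ★ `UnitaryBruhatIwahoriThree` (WILD-READY: no `|2| = 1`, no `σϖ = ±ϖ`): `K` a field with a
`ℤᵐ⁰`-valued valuation, `σ` an isometric involution (`hσ`, `hvσ`), `ϖ` a uniformiser (`hvϖ : v ϖ = exp(−1)`), `J = Φ₃` (`hJ`), `U := U(σ, Φ₃)(K)`,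
`g₁ = diag(1, 1, ϖ)` (`hg₁`), the LEVELS `K₀ := (glInt 3 K).subgroupOf U` (stabiliser of `L₀ = 𝒪³`), `K₁ := ((glInt 3 K).map (conj g₁)).subgroupOf U`
(stabiliser of `g₁L₀`), and `B = T·N` = ★ `borelU` ∕ `torusU` ∕ `unipotentU`, `w` = ★ `weylLongU`.

## Results
* §1 **the torus generator**: `exists_mem_torusU_coe_eq_mul_weylLongU_mem_conj_glInt` — `d = diag(ϖ⁻¹, 1, σϖ) ∈ T` WITH ITS MATRIX and `d·w ∈ K₁`
  (★ FILE 2 §5's element, matrix exported); `mem_sup_of_coe_eq_diag` — `d ∈ K₀ ⊔ K₁` (as `w ∈ K₀`).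
* §2 **`T ≤ K₀ ⊔ K₁`**: a torus element with unit `(0,0)`-entry is in `K₀` (`mem_glInt_subgroupOf_of_mem_torusU_of_v_eq_one`); multiplying by
  `d^{±1}` shifts the valuation of the `(0,0)`-entry by one step (`exists_mem_torusU_v_mul_eq`); induction over `ℤ` (`torusU_le_sup`).
* §3 **`N ≤ K₀ ⊔ K₁`**: `u(x, z) ∈ K₀` when `|x|, |z| ≤ 1`; `d⁻¹ u(x, z) d = u(ϖx, ϖσϖ·z)` (`exists_conj_coe_eq_upper`); every `u(x, z)` is conjugated
  into `K₀` by a power of `d` — induction over `ℕ` (`unipotentU_le_sup`).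
* §4 **`K₀ ⊔ K₁ = ⊤`** (`glInt_subgroupOf_sup_conj_glInt_eq_top`): `U = B·K₀` (★ Iwasawa) and `B = T·N ≤ K₀ ⊔ K₁`; `hd`-corollaries for ★
  `UnramifiedLocalConjDatum` ∕ ★ `LocalConjDatum`.  Equivalently [Serre1980Trees, I §4.1 Thm. 6]: `U` acts on its Bruhat–Tits tree WITHOUT a
  proper invariant subtree through the standard edge, `U = K₀ *_I K₁`.

USE.  The hypothesis `hgen : K₀ ⊔ K₁ = ⊤` of ★ `EulerPoincareLengthTwoDichotomy` (E1 row 28): together with ★ MACKEY + ★ BI (levels `(1,1,2)` of an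
unramified principal series) it yields `ep(π²(ξ)) = ep(πⁿ(ξ)) = 0` for the case-(2) constituents of [Rogawski1990, §12.2] — the `h61bRest` (i) cells
of the E1 residue matrix — with no `c`-function.

HONEST LABEL: count-neutral model brick (closes no node); h413 OPEN; HC_CM is proved only modulo the 7 printed citations (2 remaining named inputs
hLiu418 = stmt-HodgeConjecture-24832, h413 = stmt-HodgeConjecture-24833) until rung 0 closes.

## References
* [Serre1980Trees] J.-P. Serre, *Trees*, Springer (1980), Ch. I §4.1 Thm. 6 (amalgams and trees), Ch. II §1.4 (the tree of `SL₂`; `SL₂(K) = ⟨SL₂(𝒪), SL₂(𝒪)^{d}⟩`).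
* [BruhatTits1972] F. Bruhat, J. Tits, *Groupes réductifs sur un corps local I*, Publ. Math. IHÉS 41 (1972), (4.4.3) (Iwasawa), §2.1 (the affine Weyl group
  generated by the reflections in the walls of a chamber).
* [Tits1979] J. Tits, *Reductive groups over local fields*, PSPM 33.1 (1979), §2.4 (special vertices), §3.3.1–§3.3.3.
* [Kottwitz1988] R. E. Kottwitz, *Tamagawa numbers*, Ann. of Math. 127 (1988), §2 (the levels `K₀`, `K₁`, `I` of the Euler–Poincaré function).
* [Rogawski1990] J. D. Rogawski, *Automorphic Representations of Unitary Groups in Three Variables*, Ann. of Math. Stud. 123 (1990), §1.10 p. 9 (`B = TN`,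
  `d(α, β, ᾱ⁻¹)`, `u(x, z)`), §4.5 p. 45, §12.2 pp. 173–174.
-/

set_option autoImplicit false

noncomputable section

open Matrix Literature.NumberTheory.Automorphic
open scoped Matrix MatrixGroups WithZero

namespace Literature.NumberTheory.Automorphic.UnitaryGroup

variable {K : Type*} [Field K] [Valued K ℤᵐ⁰] [ValuativeRel K] [(Valued.v : Valuation K ℤᵐ⁰).Compatible]
  (σ : K →+* K) {ϖ : K} {J : Matrix (Fin 3) (Fin 3) K} (hJ : J = (StdForm.antidiagonal 3).over K)
  (hσ : ∀ a, σ (σ a) = a) (hvσ : ∀ a, Valued.v (σ a) = Valued.v a) (hvϖ : Valued.v ϖ = WithZero.exp (-1 : ℤ))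
  (g₁ : GL (Fin 3) K) (hg₁ : (g₁ : Matrix (Fin 3) (Fin 3) K) = Matrix.diagonal ![(1 : K), 1, ϖ])

/-! ## §1 The torus generator `d = diag(ϖ⁻¹, 1, σϖ)`: `d·w ∈ K₁`, hence `d ∈ K₀ ⊔ K₁` -/

include hJ hσ hvσ hvϖ hg₁ in
/-- **`d = diag(ϖ⁻¹, 1, σϖ) ∈ T` with `d·w ∈ K₁`, MATRIX EXPORTED** — the element of ★ `exists_mem_torusU_mul_weylLongU_mem_conj_glInt` (★ BI FILE 2 §5,
same computation: `g₁⁻¹ (d w) g₁ = antidiag(1, 1, σϖ∕ϖ)`, inverse `antidiag(ϖ∕σϖ, 1, 1)`, both integral as `|σϖ| = |ϖ|`), restated with the matrix of `d` so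
that consumers can conjugate by it.  No `σϖ = ϖ`. [cite: BruhatTits1972, (4.4.3)] [cite: Tits1979, §2.4, §3.3.2] [cite: Kottwitz1988, §2] -/
theorem exists_mem_torusU_coe_eq_mul_weylLongU_mem_conj_glInt :
    ∃ d ∈ torusU σ J, ((d : GL (Fin 3) K) : Matrix (Fin 3) (Fin 3) K) = !![ϖ⁻¹, 0, 0; 0, 1, 0; 0, 0, σ ϖ] ∧
      d * weylLongU σ hJ ∈ ((glInt 3 K).map (MulAut.conj g₁).toMonoidHom).subgroupOf (unitaryGroupOfForm σ J) := by
  have hϖ0 : ϖ ≠ 0 := CartanUnique.uniformizer_ne_zero hvϖ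
  have hvϖ0 : Valued.v ϖ ≠ 0 := (Valuation.ne_zero_iff _).2 hϖ0
  obtain ⟨d, hdT, hd⟩ := exists_coe_eq_diag σ hJ hσ (inv_ne_zero hϖ0) (show σ (1 : K) * 1 = 1 by rw [map_one, one_mul])
  rw [map_inv₀, inv_inv] at hd
  refine ⟨d, hdT, hd, ?_⟩
  have r0 : Fin.rev (0 : Fin 3) = 2 := rfl
  have r1 : Fin.rev (1 : Fin 3) = 1 := rfl
  have r2 : Fin.rev (2 : Fin 3) = 0 := rfl
  have hX : ∀ i j, (((d * weylLongU σ hJ : ↥(unitaryGroupOfForm σ J)) : GL (Fin 3) K) : Matrix (Fin 3) (Fin 3) K) i j =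
      (!![ϖ⁻¹, 0, 0; 0, 1, 0; 0, 0, σ ϖ] : Matrix (Fin 3) (Fin 3) K) i (Fin.rev j) := fun i j => by
    rw [coe_mul_weylLongU_apply σ hJ, hd]
  have hXi : ∀ i j, ((((d * weylLongU σ hJ : ↥(unitaryGroupOfForm σ J)) : GL (Fin 3) K)⁻¹ : GL (Fin 3) K) : Matrix (Fin 3) (Fin 3) K) i j =
      σ ((!![ϖ⁻¹, 0, 0; 0, 1, 0; 0, 0, σ ϖ] : Matrix (Fin 3) (Fin 3) K) (Fin.rev j) i) := fun i j => by
    rw [inv_apply_of_mem σ hJ, hX, Fin.rev_rev]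
  rw [mem_conj_glInt_subgroupOf_iff, _root_.Literature.NumberTheory.Automorphic.mem_glInt_iff_forall_v_le_one]
  have hconjinv : (g₁⁻¹ * ((d * weylLongU σ hJ : ↥(unitaryGroupOfForm σ J)) : GL (Fin 3) K) * g₁)⁻¹ =
      g₁⁻¹ * ((d * weylLongU σ hJ : ↥(unitaryGroupOfForm σ J)) : GL (Fin 3) K)⁻¹ * g₁ := by group
  simp only [hconjinv, coe_conj_apply_of_eq g₁ hg₁ hϖ0, hX, hXi]
  constructor
  · intro i j
    fin_cases i <;> fin_cases j <;> simp [r0, r1, r2, hϖ0, hvσ, hvϖ0]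
  · intro i j
    fin_cases i <;> fin_cases j <;> simp [r0, r1, r2, hϖ0, hσ, hvσ, hvϖ0]

omit [Valued K ℤᵐ⁰] [(Valued.v : Valuation K ℤᵐ⁰).Compatible] in
include hJ in
/-- **`d ∈ K₀ ⊔ K₁`** for any `d` with `d·w ∈ K₁`: `w ∈ K₀` (★ `weylLongU_mem_glInt_subgroupOf`) and `d = (d w) w⁻¹`.
[cite: Serre1980Trees, Ch. II §1.4] [cite: BruhatTits1972, §2.1] -/
theorem mem_sup_of_mul_weylLongU_mem {d : ↥(unitaryGroupOfForm σ J)}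
    (hdw : d * weylLongU σ hJ ∈ ((glInt 3 K).map (MulAut.conj g₁).toMonoidHom).subgroupOf (unitaryGroupOfForm σ J)) :
    d ∈ (glInt 3 K).subgroupOf (unitaryGroupOfForm σ J) ⊔ ((glInt 3 K).map (MulAut.conj g₁).toMonoidHom).subgroupOf (unitaryGroupOfForm σ J) := by
  have hw : weylLongU σ hJ ∈ (glInt 3 K).subgroupOf (unitaryGroupOfForm σ J) ⊔ ((glInt 3 K).map (MulAut.conj g₁).toMonoidHom).subgroupOf (unitaryGroupOfForm σ J) :=
    Subgroup.mem_sup_left (weylLongU_mem_glInt_subgroupOf σ hJ)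
  have h : d = (d * weylLongU σ hJ) * (weylLongU σ hJ)⁻¹ := by group
  rw [h]
  exact Subgroup.mul_mem _ (Subgroup.mem_sup_right hdw) (Subgroup.inv_mem _ hw)

/-! ## §2 `T ≤ K₀ ⊔ K₁` -/

include hJ hvσ in
/-- **A torus element with unit `(0,0)`-entry lies in `K₀`**: for `t = diag(d₀, d₁, d₂) ∈ T` the relations `σd₂·d₀ = σd₁·d₁ = 1` give
`|d₂| = |d₀|⁻¹`, `|d₁| = 1`, so `|d₀| = 1` makes every entry integral. [cite: Rogawski1990, §1.10 p. 9] [cite: Tits1979, §3.3.1] -/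
theorem mem_glInt_subgroupOf_of_mem_torusU_of_v_eq_one {t : ↥(unitaryGroupOfForm σ J)} (ht : t ∈ torusU σ J)
    (h1 : Valued.v (((t : GL (Fin 3) K) : Matrix (Fin 3) (Fin 3) K) 0 0) = 1) :
    t ∈ (glInt 3 K).subgroupOf (unitaryGroupOfForm σ J) := by
  obtain ⟨d, htM, hd20, hd11, hd02⟩ := exists_coe_eq_diagonal_of_mem_torusU σ hJ ht
  rw [htM, Matrix.diagonal_apply_eq] at h1
  -- `|d₁| = 1` from `σd₁ d₁ = 1`; `|d₂| = 1` from `σd₀ d₂ = 1` and `|d₀| = 1`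
  have hv1 : Valued.v (d 1 : K) = 1 := by
    have h := congrArg Valued.v hd11
    rw [map_mul, map_one, hvσ] at h
    rcases lt_trichotomy (Valued.v (d 1 : K)) 1 with hlt | heq | hgt
    · refine absurd h (ne_of_lt ?_)
      calc Valued.v (d 1 : K) * Valued.v (d 1 : K) ≤ Valued.v (d 1 : K) * 1 := mul_le_mul' le_rfl hlt.le
        _ < 1 := by rw [mul_one]; exact hlt
    · exact heq
    · refine absurd h (ne_of_gt ?_)
      calc (1 : ℤᵐ⁰) < Valued.v (d 1 : K) := hgt
        _ = Valued.v (d 1 : K) * 1 := (mul_one _).symm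
        _ ≤ Valued.v (d 1 : K) * Valued.v (d 1 : K) := mul_le_mul' le_rfl hgt.le
  have hv2 : Valued.v (d 2 : K) = 1 := by
    have h := congrArg Valued.v hd02
    rw [map_mul, map_one, hvσ, h1, one_mul] at h
    exact h
  rw [mem_glInt_subgroupOf_iff σ hJ hvσ]
  intro i j
  rw [htM]
  by_cases hij : i = j
  · subst hij
    rw [Matrix.diagonal_apply_eq]
    fin_cases i
    · exact h1.le
    · exact hv1.le
    · exact hv2.le
  · rw [Matrix.diagonal_apply_ne _ hij, map_zero]
    exact zero_le

omit [Valued K ℤᵐ⁰] [ValuativeRel K] [(Valued.v : Valuation K ℤᵐ⁰).Compatible] in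
include hJ in
/-- The `(0,0)`-entry of a product `s * t` with `s = diag(…)`, `t = diag(…)` in `T`: `(s t)₀₀ = s₀₀ · t₀₀`. [cite: Rogawski1990, §1.10 p. 9] -/
theorem coe_mul_apply_zero_zero_of_mem_torusU {s t : ↥(unitaryGroupOfForm σ J)} (hs : s ∈ torusU σ J) (ht : t ∈ torusU σ J) :
    (((s * t : ↥(unitaryGroupOfForm σ J)) : GL (Fin 3) K) : Matrix (Fin 3) (Fin 3) K) 0 0 =
      ((s : GL (Fin 3) K) : Matrix (Fin 3) (Fin 3) K) 0 0 * ((t : GL (Fin 3) K) : Matrix (Fin 3) (Fin 3) K) 0 0 := by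
  obtain ⟨ds, hsM, -⟩ := exists_coe_eq_diagonal_of_mem_torusU σ hJ hs
  obtain ⟨dt, htM, -⟩ := exists_coe_eq_diagonal_of_mem_torusU σ hJ ht
  rw [Subgroup.coe_mul, Units.val_mul, hsM, htM, Matrix.diagonal_mul_diagonal, Matrix.diagonal_apply_eq, Matrix.diagonal_apply_eq,
    Matrix.diagonal_apply_eq]

include hJ hσ hvσ hvϖ hg₁ in
/-- **`T ≤ K₀ ⊔ K₁`**: for `t ∈ T` with `|t₀₀| = |ϖ|^{−m}`, the element `d^{m}`-shifted `t` has a unit `(0,0)`-entry and lies in `K₀` (§2), while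
`d ∈ K₀ ⊔ K₁` (§1); induction over `m ∈ ℤ`. [cite: Serre1980Trees, Ch. II §1.4] [cite: BruhatTits1972, (4.4.3)] [cite: Rogawski1990, §1.10 p. 9] -/
theorem torusU_le_sup :
    torusU σ J ≤ (glInt 3 K).subgroupOf (unitaryGroupOfForm σ J) ⊔ ((glInt 3 K).map (MulAut.conj g₁).toMonoidHom).subgroupOf (unitaryGroupOfForm σ J) := by
  have hϖ0 : ϖ ≠ 0 := CartanUnique.uniformizer_ne_zero hvϖ
  obtain ⟨d, hdT, hdM, hdw⟩ := exists_mem_torusU_coe_eq_mul_weylLongU_mem_conj_glInt σ hJ hσ hvσ hvϖ g₁ hg₁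
  have hdS := mem_sup_of_mul_weylLongU_mem σ hJ g₁ hdw
  set S := (glInt 3 K).subgroupOf (unitaryGroupOfForm σ J) ⊔ ((glInt 3 K).map (MulAut.conj g₁).toMonoidHom).subgroupOf (unitaryGroupOfForm σ J) with hS
  -- matrix entries of `d` and `d⁻¹` at `(0,0)`
  have hd00 : ((d : GL (Fin 3) K) : Matrix (Fin 3) (Fin 3) K) 0 0 = ϖ⁻¹ := by rw [hdM]; rfl
  have hdi00 : (((d⁻¹ : ↥(unitaryGroupOfForm σ J)) : GL (Fin 3) K) : Matrix (Fin 3) (Fin 3) K) 0 0 = ϖ := by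
    rw [Subgroup.coe_inv, inv_apply_of_mem σ hJ d 0 0, hdM]
    show σ ((!![ϖ⁻¹, 0, 0; 0, 1, 0; 0, 0, σ ϖ] : Matrix (Fin 3) (Fin 3) K) 2 2) = ϖ
    simp [hσ]
  -- the claim by induction over the integer valuation of the `(0,0)`-entry
  suffices key : ∀ (m : ℤ) (t : ↥(unitaryGroupOfForm σ J)), t ∈ torusU σ J →
      Valued.v (((t : GL (Fin 3) K) : Matrix (Fin 3) (Fin 3) K) 0 0) = WithZero.exp m → t ∈ S by
    intro t ht
    obtain ⟨dt, htM, -, -, hd02⟩ := exists_coe_eq_diagonal_of_mem_torusU σ hJ ht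
    have hne : Valued.v (((t : GL (Fin 3) K) : Matrix (Fin 3) (Fin 3) K) 0 0) ≠ 0 := by
      rw [htM, Matrix.diagonal_apply_eq, Valuation.ne_zero_iff]; exact (dt 0).ne_zero
    exact key _ t ht (WithZero.exp_log hne).symm
  intro m
  induction m using Int.induction_on with
  | zero =>
    intro t ht h1
    rw [WithZero.exp_zero] at h1
    exact Subgroup.mem_sup_left (mem_glInt_subgroupOf_of_mem_torusU_of_v_eq_one σ hJ hvσ ht h1)
  | succ m ih =>
    -- `|t₀₀| = exp(m+1)`: `d⁻¹ t` has `|·₀₀| = |ϖ| exp(m+1) = exp m`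
    intro t ht h1
    have ht' : d⁻¹ * t ∈ torusU σ J := Subgroup.mul_mem _ (Subgroup.inv_mem _ hdT) ht
    have h1' : Valued.v ((((d⁻¹ * t : ↥(unitaryGroupOfForm σ J)) : GL (Fin 3) K) : Matrix (Fin 3) (Fin 3) K) 0 0) = WithZero.exp (m : ℤ) := by
      rw [coe_mul_apply_zero_zero_of_mem_torusU σ hJ (Subgroup.inv_mem _ hdT) ht, map_mul, hdi00, hvϖ, h1, ← WithZero.exp_add]
      congr 1; ring
    have hmem := ih (d⁻¹ * t) ht' h1'
    have : t = d * (d⁻¹ * t) := by group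
    rw [this]
    exact Subgroup.mul_mem _ hdS hmem
  | pred m ih =>
    -- `|t₀₀| = exp(−m−1)`: `d t` has `|·₀₀| = |ϖ|⁻¹ exp(−m−1) = exp(−m)`
    intro t ht h1
    have ht' : d * t ∈ torusU σ J := Subgroup.mul_mem _ hdT ht
    have h1' : Valued.v ((((d * t : ↥(unitaryGroupOfForm σ J)) : GL (Fin 3) K) : Matrix (Fin 3) (Fin 3) K) 0 0) = WithZero.exp (-(m : ℤ)) := by
      rw [coe_mul_apply_zero_zero_of_mem_torusU σ hJ hdT ht, map_mul, hd00, map_inv₀, hvϖ, h1, ← WithZero.exp_neg, ← WithZero.exp_add]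
      congr 1; ring
    have hmem := ih (d * t) ht' h1'
    have : t = d⁻¹ * (d * t) := by group
    rw [this]
    exact Subgroup.mul_mem _ (Subgroup.inv_mem _ hdS) hmem

/-! ## §3 `N ≤ K₀ ⊔ K₁` -/

include hJ hvσ in
/-- **`u(x, z) ∈ K₀` when `|x| ≤ 1` and `|z| ≤ 1`** (then `|−σx| ≤ 1` too). [cite: Rogawski1990, §1.10 p. 9] [cite: Tits1979, §3.3.1] -/
theorem mem_glInt_subgroupOf_of_coe_eq_upper {n : ↥(unitaryGroupOfForm σ J)} {x z : K}
    (hn : ((n : GL (Fin 3) K) : Matrix (Fin 3) (Fin 3) K) = !![1, x, z; 0, 1, -σ x; 0, 0, 1]) (hx : Valued.v x ≤ 1) (hz : Valued.v z ≤ 1) :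
    n ∈ (glInt 3 K).subgroupOf (unitaryGroupOfForm σ J) := by
  rw [Subgroup.mem_subgroupOf]
  refine mem_glInt_of_coe_eq σ hJ hvσ hn fun i j => ?_
  fin_cases i <;> fin_cases j <;> simp [Valuation.map_neg, hvσ, hx, hz]

omit [Valued K ℤᵐ⁰] [ValuativeRel K] [(Valued.v : Valuation K ℤᵐ⁰).Compatible] in
include hJ hσ in
/-- **Conjugating `N` by the torus generator**: for `n = u(x, z) ∈ N` and `d = diag(ϖ⁻¹, 1, σϖ)`, `d⁻¹ n d = u(ϖx, ϖ·σϖ·z)` — conjugation by `d⁻¹`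
MULTIPLIES the two free entries by `ϖ` and `ϖσϖ`. [cite: Rogawski1990, §1.10 p. 9] [cite: BruhatTits1972, (4.4.3)] -/
theorem coe_inv_mul_mul_eq_upper {d n : ↥(unitaryGroupOfForm σ J)} {x z : K}
    (hd : ((d : GL (Fin 3) K) : Matrix (Fin 3) (Fin 3) K) = !![ϖ⁻¹, 0, 0; 0, 1, 0; 0, 0, σ ϖ]) (hϖ0 : ϖ ≠ 0)
    (hn : ((n : GL (Fin 3) K) : Matrix (Fin 3) (Fin 3) K) = !![1, x, z; 0, 1, -σ x; 0, 0, 1]) :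
    (((d⁻¹ * n * d : ↥(unitaryGroupOfForm σ J)) : GL (Fin 3) K) : Matrix (Fin 3) (Fin 3) K) =
      !![1, ϖ * x, ϖ * σ ϖ * z; 0, 1, -σ (ϖ * x); 0, 0, 1] := by
  have hdi : (((d⁻¹ : ↥(unitaryGroupOfForm σ J)) : GL (Fin 3) K) : Matrix (Fin 3) (Fin 3) K) = !![ϖ, 0, 0; 0, 1, 0; 0, 0, σ ϖ⁻¹] := by
    ext i j
    rw [Subgroup.coe_inv, inv_apply_of_mem σ hJ d i j, hd]
    fin_cases i <;> fin_cases j <;> simp [hσ, map_inv₀]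
  rw [Subgroup.coe_mul, Subgroup.coe_mul, Units.val_mul, Units.val_mul, hdi, hn, hd]
  have hσϖ0 : σ ϖ ≠ 0 := (map_ne_zero σ).2 hϖ0
  ext i j
  fin_cases i <;> fin_cases j <;> simp [Matrix.mul_apply, Fin.sum_univ_three, hϖ0, hσϖ0, map_mul] <;> ring

include hJ hσ hvσ hvϖ hg₁ in
/-- **`N ≤ K₀ ⊔ K₁`**: `u(x, z)` with `|x| ≤ exp k`, `|z| ≤ exp 2k` is conjugated into `K₀` by `d^{k}` (`d⁻¹ u(x,z) d = u(ϖx, ϖσϖ z)` lowers the two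
valuations by one resp. two steps); induction over `k ∈ ℕ`, every `u(x, z)` being covered by some `k`. [cite: Serre1980Trees, Ch. II §1.4]
[cite: BruhatTits1972, (4.4.3)] [cite: Rogawski1990, §1.10 p. 9] -/
theorem unipotentU_le_sup :
    unipotentU σ J ≤ (glInt 3 K).subgroupOf (unitaryGroupOfForm σ J) ⊔ ((glInt 3 K).map (MulAut.conj g₁).toMonoidHom).subgroupOf (unitaryGroupOfForm σ J) := by
  have hϖ0 : ϖ ≠ 0 := CartanUnique.uniformizer_ne_zero hvϖ
  obtain ⟨d, hdT, hdM, hdw⟩ := exists_mem_torusU_coe_eq_mul_weylLongU_mem_conj_glInt σ hJ hσ hvσ hvϖ g₁ hg₁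
  have hdS := mem_sup_of_mul_weylLongU_mem σ hJ g₁ hdw
  set S := (glInt 3 K).subgroupOf (unitaryGroupOfForm σ J) ⊔ ((glInt 3 K).map (MulAut.conj g₁).toMonoidHom).subgroupOf (unitaryGroupOfForm σ J) with hS
  have hvϖσϖ : Valued.v (ϖ * σ ϖ) = WithZero.exp (-2 : ℤ) := by
    rw [map_mul, hvσ, hvϖ, ← WithZero.exp_add]; norm_num
  suffices key : ∀ (k : ℕ) (n : ↥(unitaryGroupOfForm σ J)) (x z : K),
      ((n : GL (Fin 3) K) : Matrix (Fin 3) (Fin 3) K) = !![1, x, z; 0, 1, -σ x; 0, 0, 1] →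
      Valued.v x ≤ WithZero.exp (k : ℤ) → Valued.v z ≤ WithZero.exp (2 * k : ℤ) → n ∈ S by
    intro n hn
    obtain ⟨x, z, hnM, -⟩ := exists_coe_eq_upper_of_mem_unipotentU σ hJ hσ hn
    -- choose `k` with `|x| ≤ exp k` and `|z| ≤ exp k ≤ exp 2k`
    have hbd : ∀ γ : ℤᵐ⁰, ∃ k : ℕ, γ ≤ WithZero.exp (k : ℤ) := fun γ => by
      by_cases h : γ = 0
      · exact ⟨0, by rw [h]; exact zero_le⟩
      · refine ⟨(WithZero.log γ).toNat, ?_⟩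
        conv_lhs => rw [← WithZero.exp_log h]
        rw [WithZero.exp_le_exp]
        exact Int.self_le_toNat _
    obtain ⟨kx, hkx⟩ := hbd (Valued.v x)
    obtain ⟨kz, hkz⟩ := hbd (Valued.v z)
    refine key (max kx kz) n x z hnM (hkx.trans ?_) (hkz.trans ?_)
    · rw [WithZero.exp_le_exp]; exact_mod_cast le_max_left kx kz
    · rw [WithZero.exp_le_exp]; push_cast; have := le_max_right kx kz; omega
  intro k
  induction k with
  | zero =>
    intro n x z hn hx hz
    rw [Nat.cast_zero, WithZero.exp_zero] at hx
    rw [Nat.cast_zero, mul_zero, WithZero.exp_zero] at hz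
    exact Subgroup.mem_sup_left (mem_glInt_subgroupOf_of_coe_eq_upper σ hJ hvσ hn hx hz)
  | succ k ih =>
    intro n x z hn hx hz
    have hconj := coe_inv_mul_mul_eq_upper σ hJ hσ hdM hϖ0 hn
    have hx' : Valued.v (ϖ * x) ≤ WithZero.exp (k : ℤ) := by
      rw [map_mul, hvϖ]
      calc WithZero.exp (-1 : ℤ) * Valued.v x ≤ WithZero.exp (-1 : ℤ) * WithZero.exp ((k + 1 : ℕ) : ℤ) := by gcongr
        _ = WithZero.exp (k : ℤ) := by rw [← WithZero.exp_add]; push_cast; ring_nf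
    have hz' : Valued.v (ϖ * σ ϖ * z) ≤ WithZero.exp (2 * k : ℤ) := by
      rw [map_mul, hvϖσϖ]
      calc WithZero.exp (-2 : ℤ) * Valued.v z ≤ WithZero.exp (-2 : ℤ) * WithZero.exp (2 * ((k + 1 : ℕ) : ℤ)) := by gcongr
        _ = WithZero.exp (2 * k : ℤ) := by rw [← WithZero.exp_add]; push_cast; ring_nf
    have hmem := ih (d⁻¹ * n * d) (ϖ * x) (ϖ * σ ϖ * z) hconj hx' hz'
    have : n = d * (d⁻¹ * n * d) * d⁻¹ := by group
    rw [this]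
    exact Subgroup.mul_mem _ (Subgroup.mul_mem _ hdS hmem) (Subgroup.inv_mem _ hdS)

/-! ## §4 `K₀ ⊔ K₁ = ⊤` -/

include hJ hσ hvσ hvϖ hg₁ in
/-- **`B ≤ K₀ ⊔ K₁`**: `B = T·N` (★ `borelTriple`'s Levi projection) with §2–§3. [cite: Rogawski1990, §1.10 p. 9] [cite: Serre1980Trees, Ch. II §1.4] -/
theorem borelU_le_sup :
    borelU σ J ≤ (glInt 3 K).subgroupOf (unitaryGroupOfForm σ J) ⊔ ((glInt 3 K).map (MulAut.conj g₁).toMonoidHom).subgroupOf (unitaryGroupOfForm σ J) := by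
  intro b hb
  -- Levi decomposition `b = m · (m⁻¹ b)` with `m = proj b ∈ T`, `m⁻¹ b ∈ N`
  have hN := (borelTriple σ J hJ).proj_inv_mul_mem ⟨b, hb⟩
  have hM : ((borelTriple σ J hJ).proj ⟨b, hb⟩ : ↥(unitaryGroupOfForm σ J)) ∈ torusU σ J := ((borelTriple σ J hJ).proj ⟨b, hb⟩).2
  have hb' : b = ((borelTriple σ J hJ).proj ⟨b, hb⟩ : ↥(unitaryGroupOfForm σ J)) *
      ((((borelTriple σ J hJ).proj ⟨b, hb⟩ : ↥(unitaryGroupOfForm σ J)))⁻¹ * b) := by group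
  rw [hb']
  exact Subgroup.mul_mem _ (torusU_le_sup σ hJ hσ hvσ hvϖ g₁ hg₁ hM) (unipotentU_le_sup σ hJ hσ hvσ hvϖ g₁ hg₁ hN)

include hJ hσ hvσ hvϖ hg₁ in
/-- **THE TWO VERTEX STABILISERS GENERATE: `K₀ ⊔ K₁ = U(σ, Φ₃)(K)`** — for ANY isometric involution `σ` and ANY uniformiser `ϖ` (every residue
characteristic; the ramified quadratic case included): `U = B·K₀` (★ Iwasawa `exists_mem_borelU_mem_glInt_subgroupOf_eq`) and `B ≤ K₀ ⊔ K₁` (§4).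
Tree reading: the stabilisers of the two ends of the standard edge generate the (type-preserving) automorphism group `U` of its Bruhat–Tits tree,
`U = K₀ *_{I} K₁`. [cite: Serre1980Trees, Ch. I §4.1 Thm. 6; Ch. II §1.4] [cite: BruhatTits1972, (4.4.3), §2.1] [cite: Kottwitz1988, §2] -/
theorem glInt_subgroupOf_sup_conj_glInt_eq_top :
    (glInt 3 K).subgroupOf (unitaryGroupOfForm σ J) ⊔ ((glInt 3 K).map (MulAut.conj g₁).toMonoidHom).subgroupOf (unitaryGroupOfForm σ J) = ⊤ := by
  rw [eq_top_iff]
  intro g _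
  obtain ⟨b, hb, κ, hκ, hg⟩ := exists_mem_borelU_mem_glInt_subgroupOf_eq σ hJ hσ hvσ g
  rw [hg]
  exact Subgroup.mul_mem _ (borelU_le_sup σ hJ hσ hvσ hvϖ g₁ hg₁ hb) (Subgroup.mem_sup_left hκ)

include hJ hσ hvσ hvϖ hg₁ in
/-- The symmetric spelling `K₁ ⊔ K₀ = ⊤`. [cite: Serre1980Trees, Ch. I §4.1 Thm. 6] -/
theorem conj_glInt_subgroupOf_sup_glInt_eq_top :
    ((glInt 3 K).map (MulAut.conj g₁).toMonoidHom).subgroupOf (unitaryGroupOfForm σ J) ⊔ (glInt 3 K).subgroupOf (unitaryGroupOfForm σ J) = ⊤ := by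
  rw [sup_comm]; exact glInt_subgroupOf_sup_conj_glInt_eq_top σ hJ hσ hvσ hvϖ g₁ hg₁

/-- `K₀ ⊔ K₁ = ⊤` under ★ `UnramifiedLocalConjDatum σ ϖ` (unramified places, every residue characteristic). [cite: Serre1980Trees, Ch. I §4.1 Thm. 6] [cite: Kottwitz1988, §2] -/
theorem _root_.Literature.NumberTheory.Automorphic.HermitianLattice.UnramifiedLocalConjDatum.glInt_subgroupOf_sup_conj_glInt_eq_top
    (hd : HermitianLattice.UnramifiedLocalConjDatum σ ϖ) (hJ : J = (StdForm.antidiagonal 3).over K) (g₁ : GL (Fin 3) K)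
    (hg₁ : (g₁ : Matrix (Fin 3) (Fin 3) K) = Matrix.diagonal ![(1 : K), 1, ϖ]) :
    (glInt 3 K).subgroupOf (unitaryGroupOfForm σ J) ⊔ ((glInt 3 K).map (MulAut.conj g₁).toMonoidHom).subgroupOf (unitaryGroupOfForm σ J) = ⊤ :=
  UnitaryGroup.glInt_subgroupOf_sup_conj_glInt_eq_top σ hJ hd.σσ hd.vσ hd.vϖ g₁ hg₁

/-- `K₀ ⊔ K₁ = ⊤` under the non-dyadic datum ★ `LocalConjDatum σ ϖ` (tame places). [cite: Serre1980Trees, Ch. I §4.1 Thm. 6] [cite: Tits1979, §2.4] -/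
theorem _root_.Literature.NumberTheory.Automorphic.HermitianLattice.LocalConjDatum.glInt_subgroupOf_sup_conj_glInt_eq_top
    (hd : HermitianLattice.LocalConjDatum σ ϖ) (hJ : J = (StdForm.antidiagonal 3).over K) (g₁ : GL (Fin 3) K)
    (hg₁ : (g₁ : Matrix (Fin 3) (Fin 3) K) = Matrix.diagonal ![(1 : K), 1, ϖ]) :
    (glInt 3 K).subgroupOf (unitaryGroupOfForm σ J) ⊔ ((glInt 3 K).map (MulAut.conj g₁).toMonoidHom).subgroupOf (unitaryGroupOfForm σ J) = ⊤ :=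
  UnitaryGroup.glInt_subgroupOf_sup_conj_glInt_eq_top σ hJ hd.σσ hd.vσ hd.vϖ g₁ hg₁

end Literature.NumberTheory.Automorphic.UnitaryGroup

end
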